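import Mathlib

/-!
# Sketch — res-L1-w45b-idea-2 (IDEATOR 2, gen 12), CRUX-IDEATE on stmt-ResolutionOfSingularities-20148
# (EL♮(3) = `Theses.EquisingularLift.EquisingularLiftNatThree`; B-residue stubs of CHILD v33
# `stub_elnat_three_isolated_nonDefTowerB` / `stub_elnat_three_nonisolated_nonDefNoseTowerB`).

[OURS · L1 W4.5(b)] First lemmas of the two crux idea cards of this session, as SORRIED statements that elaborate
(no proof is claimed; nothing of [Hironaka2017] is asserted; AI-written, weaker than expert review).

* (S1) card `tower-hilbert-closure` — «FLAT AND OF FINITE TYPE OVER A COMPLETE DVR ⇒ A POINT OVER A FINITE (RAMIFIED)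
  EXTENSION THROUGH EVERY CLOSED POINT OF THE SPECIAL FIBRE». Applied to an affine chart of the Hilbert scheme of towers
  (resp. of the running stage) at the downstairs tower (resp. centre), whose flatness at that point is the output of the
  LANDED cores `…Theorems.EquisingularLift.ExpectedDimension.boeckleFlatOfExpectedDim` (p506851) /
  `…ExpectedComponentLifts` (EDL♯) under the expected-dimension count, it yields the O″-valued tower, i.e. EL♮(3)(H) over O″.
* (S2) card `tower-hilbert-closure`, razor side — «a hull that is formally smooth modulo ϖ and has no O/ϖ²-point contains ϖ»:
  the maximally-mobile-and-obstructed centre is unperformable in the current O-ambient over EVERY finite extension.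
* (S3) card `jump-class-steering` — «a generic JUMP of the lifted carrier's normal bundle kills the destabilising direction over
  every extension»: the rank-2 bundle on ℙ¹_O with transition matrix `[[T^(ℓ-2), t·T^(ℓ-1)], [0, T^ℓ]]`, `0 ≠ t ∈ 𝔪_O`, is not
  equivalent over `O` to the split one (special fibre `O(ℓ-2) ⊕ O(ℓ)`, generic fibre `O(ℓ-1)²`).
-/

set_option linter.dupNamespace false
set_option linter.overlappingInstances false

namespace Summit.ResolutionOfSingularities.ResolutionOfSingularities.Cruxes.EquisingularLiftNatThree.Idea2

open IsLocalRing

/-- (S1) «flat + finite type over a complete DVR ⇒ an `O′`-point through the given closed point of the special fibre,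
`O ⊆ O′` a finite extension of DVRs». [OURS · sorried · TRUE: dimension formula for the flat local map `O → A_𝔪`,
cut by a lift of a system of parameters of `(A/ϖ)_𝔪` to a quasi-finite `B`, Henselian splitting `B = B_fin × B'`,
a one-dimensional branch of `B_fin` dominates `O`, normalise (complete DVR ⇒ Japanese). Stacks 04GG, 0C2Y; EGA IV 14.5.3.] -/
theorem stub_exists_dvrPoint_of_flat_finiteType :
    ∀ (O : Type) [CommRing O] [IsDomain O] [IsDiscreteValuationRing O]
      [IsAdicComplete (maximalIdeal O) O]
      (A : Type) [CommRing A] [Algebra O A] [Algebra.FiniteType O A] [Module.Flat O A]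
      (𝔪 : Ideal A) [𝔪.IsMaximal],
      (maximalIdeal O).map (algebraMap O A) ≤ 𝔪 →
      ∃ (O' : Type) (_ : CommRing O') (_ : IsDomain O') (_ : IsDiscreteValuationRing O')
        (_ : Algebra O O') (_ : Module.Finite O O'),
        Function.Injective (algebraMap O O') ∧
        ∃ f : A →ₐ[O] O', 𝔪 = (maximalIdeal O').comap f := by
  sorry

/-- (S2) RAZOR CORE. `O` local with principal maximal ideal `(ϖ)`, `J` an ideal of `O⟦x_σ⟧` (σ finite) contained in `(ϖ)`
(«the hull is formally smooth of maximal dimension modulo ϖ») and NOT contained in `(ϖ²) + (x_σ)` («no `O/ϖ²`-valued point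
over the origin», i.e. the first-order obstruction of the centre itself is non-zero) ⇒ `ϖ ∈ J`, so the hull `O⟦x⟧/J` is
killed by `ϖ` and has no point with values in any `O`-torsion-free `O`-algebra — in particular in no finite extension `O″`.
[OURS · sorried · TRUE: `j = ϖ·h ∈ J` with `h ∉ (ϖ, x)` ⇒ `h` is a unit.] -/
theorem stub_C_mem_of_smoothModVarpi_of_noFirstOrderPoint :
    ∀ (O : Type) [CommRing O] [IsLocalRing O] (ϖ : O), maximalIdeal O = Ideal.span {ϖ} →
    ∀ (σ : Type) [Fintype σ] (J : Ideal (MvPowerSeries σ O)),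
      J ≤ Ideal.span {(MvPowerSeries.C ϖ : MvPowerSeries σ O)} →
      ¬ (J ≤ Ideal.span {(MvPowerSeries.C (ϖ ^ 2) : MvPowerSeries σ O)} ⊔
            Ideal.span (Set.range (MvPowerSeries.X : σ → MvPowerSeries σ O))) →
      (MvPowerSeries.C ϖ : MvPowerSeries σ O) ∈ J := by
  sorry

open LaurentPolynomial in
/-- (S3) JUMP KILLS THE DESTABILISING DIRECTION. Over a DVR `O`, for `0 ≠ t ∈ 𝔪_O` and `ℓ ≥ 2`, the rank-2 bundle on `ℙ¹_O`
glued along `Spec O[T,T⁻¹]` by `g_t = [[T^(ℓ-2), t·T^(ℓ-1)], [0, T^ℓ]]` is NOT equivalent (left: `GL₂(O[T])`, right: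
`GL₂(O[T⁻¹])`) to `g_0 = diag(T^(ℓ-2), T^ℓ)`: its special fibre is `O(ℓ-2) ⊕ O(ℓ)` (t ≡ 0) but its generic fibre is
`O(ℓ-1) ⊕ O(ℓ-1)` (t a unit in K), and splitting types are invariants. Hence the destabilising sub-line-bundle `O(ℓ)` of the
special fibre — the direction `L` of the section round — does not lift to a sub-line-bundle over `O`, nor over any finite
`O″ ⊇ O` (`t ≠ 0` in `O″`). [OURS · sorried · TRUE.] -/
theorem stub_not_split_of_jump :
    ∀ (O : Type) [CommRing O] [IsDomain O] [IsDiscreteValuationRing O] (t : O), t ≠ 0 → t ∈ maximalIdeal O →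
    ∀ ℓ : ℕ, 2 ≤ ℓ →
    ¬ ∃ (P Q : Matrix (Fin 2) (Fin 2) (Polynomial O)), IsUnit P ∧ IsUnit Q ∧
        (P.map Polynomial.toLaurent) *
            !![T ((ℓ : ℤ) - 2), LaurentPolynomial.C t * T ((ℓ : ℤ) - 1); 0, T (ℓ : ℤ)] *
          ((Q.map Polynomial.toLaurent).map LaurentPolynomial.invert) =
        !![T ((ℓ : ℤ) - 2), 0; 0, T (ℓ : ℤ)] := by
  sorry

end Summit.ResolutionOfSingularities.ResolutionOfSingularities.Cruxes.EquisingularLiftNatThree.Idea2
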